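import Literature.Geometry.Lorentzian.MinkowskiLargeRCurrent
import Literature.Geometry.Lorentzian.KerrSchildMultiplierPerturbation
import Literature.Geometry.Lorentzian.KerrSchildDerivativeDecay
import HarnessLib

/-!
# The Dafermos–Rodnianski large-`r` current on Kerr: coercivity of the first-order bulk

(family `gr`; infrastructure for statement **gr.S24** — Dafermos–Rodnianski–Shlapentokh-Rothman,
arXiv:1402.7034 = Ann. of Math. 183 (2016), §4.6, Prop. 4.6.1; Dafermos–Rodnianski
arXiv:1010.5132, §6 — in the coefficient-field framework of `KerrSchild.multiplierBulk`; namespace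
`Literature.Geometry.Lorentzian.KerrSchild`)

`MinkowskiLargeRCurrent.lean` proves the model estimate of Dafermos–Rodnianski's large-`r`
current `X = (1 − r^{−δ})∂_r` with weight `ϖ`: on Minkowski space, for `0 < δ ≤ 1` and
`r = |y⃗| ≥ 2^{1/δ}`,
`K^X[η] + ¼ϖ η^{αβ}p_αp_β ≥ (δ/4) r^{−1−δ} ∑_μ p_μ²` (`KerrSchild.largeR_firstOrder_lower_bound`).
DRSR §4.6 / DR §6 assert that "this inequality is preserved when `X`, `w` are defined for
`g_{M,a}`", for `r` large. This file proves that statement for the **first-order bulk**, with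
explicit constants: by `KerrSchild.multiplierBulk_ge_of_perturbation`
(`KerrSchildMultiplierPerturbation.lean`) and the decay bounds
`|g^{αβ} − η^{αβ}| ≤ 2M/r`, `|∂_μ g^{αβ}| ≤ 216 M/r²` of `KerrSchildDerivativeDecay.lean`
(Kerr–Schild radius `r = r(x) ≥ |a|`), together with the bounds `|X^α| ≤ 1`, `|∂_μX^β| ≤ 4/|y⃗|`
on the multiplier and `0 ≤ ¼ϖ ≤ 3/(2|y⃗|)` on the weight proved here,

* `KerrSchild.kerr_largeR_firstOrder_lower_bound`: for `M ≥ 0`, `0 < δ ≤ 1`, at a point `x` with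
  `|y⃗| ≥ 2^{1/δ}` and Kerr–Schild radius `r ≥ |a|`, `r > 0`,
  `K^X[g⁻¹_{M,a}](x) + ¼ϖ(x) ∑_{αβ} g^{αβ}(x) p_α p_β ≥ ((δ/4)|y⃗|^{−1−δ} − 1932 M/r²) ∑_μ p_μ²`
  (`p_μ = ∂_μw(x)`), the left side being exactly the first-order bulk of the modified current
  `J^X + ¼L_ϖ` in the divergence identity `KerrSchild.sum_fderiv_modifiedCurrent`;
* `KerrSchild.kerr_largeR_firstOrder_lower_bound_radius`: the same with the Kerr–Schild radius
  throughout, `≥ ((δ/16) r^{−1−δ} − 1932 M/r²) ∑ p²` for `r ≥ 2^{1/δ}` (`|y⃗| ≤ r + |a| ≤ 2r`);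
* `KerrSchild.kerr_largeR_firstOrder_coercive`: **for `δ r^{1−δ} ≥ 61824 M` the first-order
  bulk is `≥ (δ/32) r^{−1−δ} ∑_μ (∂_μw)²`** — the Kerr form of DR's
  `K^{X,w} ≥ b(δ) r^{−1−δ} |∂ψ|²` for `r ≥ R(δ, M)` (arXiv:1010.5132, §6; DRSR §4.6: "for `R`
  sufficiently large, the large-`r` current of our previous [work] can be applied").

The zeroth-order term `−⅛(□_g ϖ) w²` (model: `KerrSchild.largeR_zerothOrder_lower_bound`) is not
treated here. No definitions, no named facts (D-0026).

## References

* M. Dafermos, I. Rodnianski, Y. Shlapentokh-Rothman, *Decay for solutions of the wave equation on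
  Kerr exterior spacetimes III: the full subextremal case `|a| < M`*, Ann. of Math. 183 (2016),
  arXiv:1402.7034, §4.6, Prop. 4.6.1 (key `DafermosRodnianskiShlapentokhrothman2014`).
* M. Dafermos, I. Rodnianski, *Decay for solutions of the wave equation on Kerr exterior spacetimes
  I–II: the cases `|a| ≪ M` or axisymmetry*, arXiv:1010.5132, §6 (key `DafermosRodnianski2010`).
-/

noncomputable section

open Set Filter
open scoped Topology Real

namespace Literature.Geometry.Lorentzian

namespace KerrSchild

/-! ### Pointwise bounds on the multiplier `X_δ` and the weight `ϖ_δ` at `|y⃗| ≥ 1` -/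

/-- `|x_α| ≤ |y⃗|(x)` for a spatial index `α ≠ 0`. [folklore] -/
theorem abs_apply_le_spatialNorm (x : E4) {α : Fin 4} (hα : α ≠ 0) : |x α| ≤ E4.spatialNorm x := by
  obtain ⟨i, rfl⟩ : ∃ i : Fin 3, α = i.succ := ⟨α.pred hα, (Fin.succ_pred α hα).symm⟩
  have h := PiLp.norm_apply_le (E4.spatial x) i
  rw [E4.spatial_apply, Real.norm_eq_abs] at h
  exact h

/-- **`|X^α| ≤ 1`** for the Dafermos–Rodnianski multiplier `X⁰ = 0`,
`X^i = (s^{−1/2} − s^{−(1+δ)/2}) y_i` (`s = |y⃗|²`, i.e. `X = (1 − r^{−δ})∂_r`), `δ > 0`, at points with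
`|y⃗| ≥ 1` (`0 ≤ r^{−1} − r^{−1−δ} ≤ r^{−1}`, `|y_i| ≤ r`). [cite: DafermosRodnianski2010, §6] -/
theorem abs_largeRMultiplier_le_one {δ : ℝ} (hδ0 : 0 < δ) {x : E4} (hx1 : 1 ≤ E4.spatialNorm x)
    (α : Fin 4) :
    |(if α = 0 then (0 : ℝ) else
        ((E4.spatialNorm x ^ 2) ^ (-(1 / 2 : ℝ)) - (E4.spatialNorm x ^ 2) ^ (-(1 + δ) / 2)) * x α)| ≤
      1 := by
  by_cases hα : α = 0
  · simp [hα]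
  · simp only [hα, if_false]
    have hxα : |x α| ≤ E4.spatialNorm x := abs_apply_le_spatialNorm x hα
    set r := E4.spatialNorm x with hr_def
    have hr : 0 < r := one_pos.trans_le hx1
    have hA : (r ^ 2) ^ (-(1 / 2 : ℝ)) = r⁻¹ := by
      rw [← Real.rpow_two, ← Real.rpow_mul hr.le, show (2 : ℝ) * -(1 / 2) = -1 by norm_num,
        Real.rpow_neg_one]
    have hB0 : 0 ≤ (r ^ 2) ^ (-(1 + δ) / 2) := Real.rpow_nonneg (by positivity) _
    have hBA : (r ^ 2) ^ (-(1 + δ) / 2) ≤ (r ^ 2) ^ (-(1 / 2 : ℝ)) :=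
      Real.rpow_le_rpow_of_exponent_le (by nlinarith) (by linarith)
    have hg : |(r ^ 2) ^ (-(1 / 2 : ℝ)) - (r ^ 2) ^ (-(1 + δ) / 2)| ≤ r⁻¹ := by
      rw [abs_of_nonneg (sub_nonneg.2 hBA), ← hA]
      linarith
    rw [abs_mul]
    calc _ ≤ r⁻¹ * r := mul_le_mul hg hxα (abs_nonneg _) (by positivity)
      _ = 1 := inv_mul_cancel₀ hr.ne'

/-- **`|∂_μ X^β| ≤ 4/|y⃗|`** for the Dafermos–Rodnianski multiplier (`0 < δ ≤ 1`, `|y⃗| ≥ 1`):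
`∂_μ X^β = g'(s) 2y_μ y_β + g(s) δ_μ^β` (`KerrSchild.fderiv_radialMultiplier_apply`) with
`|g| ≤ r^{−1}` and `s|g'| = |−½ r^{−1} + ((1+δ)/2) r^{−1−δ}| ≤ (3/2) r^{−1}`.
[cite: DafermosRodnianski2010, §6] -/
theorem abs_fderiv_largeRMultiplier_le {δ : ℝ} (hδ0 : 0 < δ) (hδ1 : δ ≤ 1) {x : E4}
    (hx1 : 1 ≤ E4.spatialNorm x) (μ β : Fin 4) :
    |fderiv ℝ (fun y : E4 ↦ if β = 0 then (0 : ℝ) else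
        ((E4.spatialNorm y ^ 2) ^ (-(1 / 2 : ℝ)) - (E4.spatialNorm y ^ 2) ^ (-(1 + δ) / 2)) * y β) x
        (E4.basisVector μ)| ≤ 4 * (E4.spatialNorm x)⁻¹ := by
  have hxβ' : β ≠ 0 → |x β| ≤ E4.spatialNorm x := fun hβ ↦ abs_apply_le_spatialNorm x hβ
  have hxμ' : μ ≠ 0 → |x μ| ≤ E4.spatialNorm x := fun hμ ↦ abs_apply_le_spatialNorm x hμ
  set r := E4.spatialNorm x with hr_def
  have hr : 0 < r := one_pos.trans_le hx1
  have hs : 0 < r ^ 2 := by positivity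
  have hg := hasDerivAt_largeRSeed δ hs
  rw [fderiv_radialMultiplier_apply hg β μ]
  by_cases hβ : β = 0
  · simp only [hβ, if_true, abs_zero]
    positivity
  simp only [hβ, if_false]
  have hxβ : |x β| ≤ r := hxβ' hβ
  -- `A = r⁻¹`, `B = r^{-1-δ} ≤ A`
  have hA : (r ^ 2) ^ (-(1 / 2 : ℝ)) = r⁻¹ := by
    rw [← Real.rpow_two, ← Real.rpow_mul hr.le, show (2 : ℝ) * -(1 / 2) = -1 by norm_num,
      Real.rpow_neg_one]
  have e1 : r ^ 2 * (r ^ 2) ^ (-(1 / 2 : ℝ) - 1) = (r ^ 2) ^ (-(1 / 2 : ℝ)) := mul_rpow_sub_one hs _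
  have e2 : r ^ 2 * (r ^ 2) ^ (-(1 + δ) / 2 - 1) = (r ^ 2) ^ (-(1 + δ) / 2) := mul_rpow_sub_one hs _
  set A := (r ^ 2) ^ (-(1 / 2 : ℝ)) with hA_def
  set B := (r ^ 2) ^ (-(1 + δ) / 2) with hB_def
  have hB0 : 0 ≤ B := Real.rpow_nonneg hs.le _
  have hBA : B ≤ A := Real.rpow_le_rpow_of_exponent_le (by nlinarith) (by linarith)
  have hA0 : 0 ≤ A := hB0.trans hBA
  -- the derivative of the seed, times `s`
  set g' := -(1 / 2 : ℝ) * (r ^ 2) ^ (-(1 / 2 : ℝ) - 1) - -(1 + δ) / 2 * (r ^ 2) ^ (-(1 + δ) / 2 - 1)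
    with hg'_def
  have hsg : r ^ 2 * g' = -(1 / 2) * A + (1 + δ) / 2 * B := by
    have : r ^ 2 * g' = -(1 / 2) * (r ^ 2 * (r ^ 2) ^ (-(1 / 2 : ℝ) - 1)) +
        (1 + δ) / 2 * (r ^ 2 * (r ^ 2) ^ (-(1 + δ) / 2 - 1)) := by
      rw [hg'_def]; ring
    rw [this, e1, e2]
  have hg'abs : |g'| * r ^ 2 ≤ 3 / 2 * A := by
    rw [← abs_of_pos hs, ← abs_mul, mul_comm, hsg]
    have hcB : 0 ≤ (1 + δ) / 2 * B := by positivity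
    have hcB' : (1 + δ) / 2 * B ≤ B := mul_le_of_le_one_left hB0 (by linarith)
    have habs : |-(1 / 2) * A + (1 + δ) / 2 * B| ≤ 1 / 2 * A + (1 + δ) / 2 * B :=
      abs_le.2 ⟨by linarith, by linarith⟩
    linarith
  -- the two terms
  have h1 : |g' * (if μ = 0 then 0 else 2 * x μ) * x β| ≤ 3 * r⁻¹ := by
    have hxμ : |(if μ = 0 then (0 : ℝ) else 2 * x μ)| ≤ 2 * r := by
      split_ifs with hμ
      · rw [abs_zero]; positivity
      · rw [abs_mul, abs_two]
        exact mul_le_mul_of_nonneg_left (hxμ' hμ) two_pos.le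
    calc |g' * (if μ = 0 then 0 else 2 * x μ) * x β|
        = |g'| * |(if μ = 0 then (0 : ℝ) else 2 * x μ)| * |x β| := by rw [abs_mul, abs_mul]
      _ ≤ |g'| * (2 * r) * r := by gcongr
      _ = 2 * (|g'| * r ^ 2) := by ring
      _ ≤ 2 * (3 / 2 * A) := by gcongr
      _ = 3 * r⁻¹ := by rw [hA]; ring
  have h2 : |(A - B) * (if β = μ then 1 else 0)| ≤ r⁻¹ := by
    have hind : |(if β = μ then (1 : ℝ) else 0)| ≤ 1 := by split_ifs <;> simp
    rw [abs_mul, abs_of_nonneg (sub_nonneg.2 hBA)]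
    calc (A - B) * |(if β = μ then (1 : ℝ) else 0)| ≤ (A - B) * 1 :=
          mul_le_mul_of_nonneg_left hind (sub_nonneg.2 hBA)
      _ ≤ A := by linarith
      _ = r⁻¹ := hA
  calc _ ≤ |g' * (if μ = 0 then 0 else 2 * x μ) * x β| + |(A - B) * (if β = μ then 1 else 0)| :=
        abs_add_le _ _
    _ ≤ 3 * r⁻¹ + r⁻¹ := add_le_add h1 h2
    _ = 4 * r⁻¹ := by ring

/-- The weight of the modified current: `¼ϖ_δ = r^{−1} − r^{−1−δ} + (δ/2) r^{−1−2δ}` at `r = |y⃗| > 0`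
(`ϖ_δ(y) = 4(s^{−1/2} − s^{−(1+δ)/2} + (δ/2)s^{−(1+2δ)/2})`, `s = |y⃗|²`, the weight of
`KerrSchild.largeR_zerothOrder_lower_bound`). [cite: DafermosRodnianski2010, §6] -/
theorem largeRWeight_quarter_eq (δ : ℝ) {x : E4} (hx : 0 < E4.spatialNorm x) :
    4⁻¹ * (4 * ((E4.spatialNorm x ^ 2) ^ (-(1 / 2 : ℝ)) - (E4.spatialNorm x ^ 2) ^ (-((1 + δ) / 2)) +
        δ / 2 * (E4.spatialNorm x ^ 2) ^ (-((1 + 2 * δ) / 2)))) =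
      E4.spatialNorm x ^ (-1 : ℝ) - E4.spatialNorm x ^ (-1 - δ) +
        δ / 2 * E4.spatialNorm x ^ (-1 - 2 * δ) := by
  set r := E4.spatialNorm x with hr_def
  have hA : (r ^ 2) ^ (-(1 / 2 : ℝ)) = r ^ (-1 : ℝ) := by
    rw [← Real.rpow_two, ← Real.rpow_mul hx.le]; norm_num
  have hB : (r ^ 2) ^ (-((1 + δ) / 2)) = r ^ (-1 - δ) := by
    rw [← Real.rpow_two, ← Real.rpow_mul hx.le]; ring_nf
  have hC : (r ^ 2) ^ (-((1 + 2 * δ) / 2)) = r ^ (-1 - 2 * δ) := by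
    rw [← Real.rpow_two, ← Real.rpow_mul hx.le]; ring_nf
  rw [hA, hB, hC]
  ring

/-- **`0 ≤ ¼ϖ_δ ≤ 3/(2r)`** at `r = |y⃗| ≥ 1` for `0 < δ ≤ 1` (`r^{−1−δ} ≤ r^{−1}`,
`0 ≤ r^{−1−2δ} ≤ r^{−1}`). [cite: DafermosRodnianski2010, §6] -/
theorem largeRWeight_quarter_bounds {δ : ℝ} (hδ0 : 0 < δ) (hδ1 : δ ≤ 1) {x : E4}
    (hx1 : 1 ≤ E4.spatialNorm x) :
    0 ≤ E4.spatialNorm x ^ (-1 : ℝ) - E4.spatialNorm x ^ (-1 - δ) +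
        δ / 2 * E4.spatialNorm x ^ (-1 - 2 * δ) ∧
      E4.spatialNorm x ^ (-1 : ℝ) - E4.spatialNorm x ^ (-1 - δ) +
        δ / 2 * E4.spatialNorm x ^ (-1 - 2 * δ) ≤ 3 / 2 * (E4.spatialNorm x)⁻¹ := by
  set r := E4.spatialNorm x with hr_def
  have hr : 0 < r := one_pos.trans_le hx1
  have hA : r ^ (-1 : ℝ) = r⁻¹ := Real.rpow_neg_one r
  have hB0 : 0 ≤ r ^ (-1 - δ) := Real.rpow_nonneg hr.le _
  have hBA : r ^ (-1 - δ) ≤ r ^ (-1 : ℝ) := Real.rpow_le_rpow_of_exponent_le hx1 (by linarith)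
  have hC0 : 0 ≤ r ^ (-1 - 2 * δ) := Real.rpow_nonneg hr.le _
  have hCA : r ^ (-1 - 2 * δ) ≤ r ^ (-1 : ℝ) := Real.rpow_le_rpow_of_exponent_le hx1 (by linarith)
  have hδC : δ / 2 * r ^ (-1 - 2 * δ) ≤ 1 / 2 * r ^ (-1 : ℝ) := by
    calc δ / 2 * r ^ (-1 - 2 * δ) ≤ 1 / 2 * r ^ (-1 - 2 * δ) := by gcongr
      _ ≤ 1 / 2 * r ^ (-1 : ℝ) := by gcongr
  rw [← hA]
  constructor
  · nlinarith [mul_nonneg hδ0.le hC0]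
  · linarith

/-- The Minkowski quadratic form: `∑_{αβ} η^{αβ} p_α p_β = −p₀² + (p₁² + p₂² + p₃²)`. [folklore] -/
theorem sum_sum_etaComp_mul_mul (p : Fin 4 → ℝ) :
    ∑ α, ∑ β, Kerr.etaComp α β * p α * p β = -p 0 ^ 2 + (p 1 ^ 2 + p 2 ^ 2 + p 3 ^ 2) := by
  simp [Fin.sum_univ_four, Kerr.etaComp]
  ring

/-! ### The first-order bulk of the large-`r` current on Kerr -/

/-- **Coercivity of the first-order bulk of the Dafermos–Rodnianski large-`r` current on Kerr.**
Let `M ≥ 0`, `0 < δ ≤ 1`, and let `x` be a point with `|y⃗|(x) ≥ 2^{1/δ}` whose Kerr–Schild radius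
satisfies `r = r(x) > 0`, `r ≥ |a|`. For the multiplier `X⁰ = 0`,
`X^i = (s^{−1/2} − s^{−(1+δ)/2}) y_i` (`s = |y⃗|²`) and the weight
`ϖ = 4(s^{−1/2} − s^{−(1+δ)/2} + (δ/2)s^{−(1+2δ)/2})`, with `p_μ = ∂_μw(x)`:
`K^X[g⁻¹_{M,a}](x) + ¼ϖ(x) ∑_{αβ} g^{αβ}(x) p_α p_β ≥ ((δ/4)|y⃗|^{−1−δ} − 1932 M/r²) ∑_μ p_μ²`.
Proof: the Minkowski model `KerrSchild.largeR_firstOrder_lower_bound`, the perturbation lemma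
`KerrSchild.multiplierBulk_ge_of_perturbation` with `h₀ = 2M/r`, `h₁ = 216 M/r²`
(`KerrSchildDerivativeDecay.lean`), `ξ₀ = 1`, `ξ₁ = 4/|y⃗|`, and
`|¼ϖ ∑(g − η)^{αβ}p_αp_β| ≤ (3/(2|y⃗|)) (2M/r) 4∑p²`; `|y⃗| ≥ r`. This is the quantitative form
of "this inequality is preserved when `X`, `w` are defined for `g_{M,a}`" (DRSR arXiv:1402.7034,
§4.6; Dafermos–Rodnianski arXiv:1010.5132, §6) for the first-order terms.
[cite: DafermosRodnianskiShlapentokhrothman2014, §4.6] -/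
theorem kerr_largeR_firstOrder_lower_bound {δ M a : ℝ} (hδ0 : 0 < δ) (hδ1 : δ ≤ 1) (hM : 0 ≤ M)
    (w : E4 → ℝ) {x : E4} (hx : (2 : ℝ) ^ (1 / δ) ≤ E4.spatialNorm x)
    (hr : 0 < Kerr.radius a x) (hax : |a| ≤ Kerr.radius a x) :
    (δ / 4 * E4.spatialNorm x ^ (-1 - δ) - 1932 * M / Kerr.radius a x ^ 2) *
        ∑ μ, fderiv ℝ w x (E4.basisVector μ) ^ 2 ≤
      multiplierBulk (Kerr.inverseMetric M a)
          (fun y α ↦ if α = 0 then (0 : ℝ) else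
            ((E4.spatialNorm y ^ 2) ^ (-(1 / 2 : ℝ)) - (E4.spatialNorm y ^ 2) ^ (-(1 + δ) / 2)) * y α)
          w x +
        4⁻¹ * ((4 * ((E4.spatialNorm x ^ 2) ^ (-(1 / 2 : ℝ)) -
            (E4.spatialNorm x ^ 2) ^ (-((1 + δ) / 2)) +
              δ / 2 * (E4.spatialNorm x ^ 2) ^ (-((1 + 2 * δ) / 2)))) *
          ∑ α, ∑ β, Kerr.inverseMetric M a x α β * fderiv ℝ w x (E4.basisVector α) *
            fderiv ℝ w x (E4.basisVector β)) := by
  -- the two radii `ρ = |y⃗| ≥ rK = r(x) > 0`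
  have h2 : 0 < (2 : ℝ) ^ (1 / δ) := Real.rpow_pos_of_pos (by norm_num) _
  have h21 : (1 : ℝ) ≤ (2 : ℝ) ^ (1 / δ) := Real.one_le_rpow (by norm_num) (by positivity)
  have hρ1 : 1 ≤ E4.spatialNorm x := h21.trans hx
  have hρ : 0 < E4.spatialNorm x := one_pos.trans_le hρ1
  have hrρ : Kerr.radius a x ≤ E4.spatialNorm x := by
    have hr' : 0 < Kerr.radius a (E4.ofTimeSpace 0 (E4.spatial x)) := by
      rwa [Kerr.radius_ofTimeSpace_spatial]
    have h := Kerr.radius_le_norm hr'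
    rwa [Kerr.radius_ofTimeSpace_spatial] at h
  -- the model estimate and the perturbation lemma
  have hmodel := largeR_firstOrder_lower_bound hδ0 hδ1 w hx
  have hG : ∀ α β, DifferentiableAt ℝ (fun y ↦ Kerr.inverseMetric M a y α β) x := fun α β ↦
    (Kerr.contDiffAt_inverseMetric M a hr α β (n := 1)).differentiableAt one_ne_zero
  have hG' : ∀ α β, DifferentiableAt ℝ (fun y ↦ (fun _ : E4 ↦ Kerr.etaComp) y α β) x :=
    fun _ _ ↦ differentiableAt_const _
  have hH := fun α β ↦ Kerr.abs_inverseMetric_sub_eta_apply_le hM hr α β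
  have hdH := fun μ α β ↦
    Kerr.abs_fderiv_inverseMetric_sub_eta_basisVector_le_of_abs_le hM hr hax μ α β
  have hX := fun α ↦ abs_largeRMultiplier_le_one (x := x) hδ0 hρ1 α
  have hdX := fun μ β ↦ abs_fderiv_largeRMultiplier_le (x := x) hδ0 hδ1 hρ1 μ β
  have hpert := multiplierBulk_ge_of_perturbation
    (G := Kerr.inverseMetric M a) (G' := fun _ : E4 ↦ Kerr.etaComp)
    (fun y α ↦ if α = 0 then (0 : ℝ) else
      ((E4.spatialNorm y ^ 2) ^ (-(1 / 2 : ℝ)) - (E4.spatialNorm y ^ 2) ^ (-(1 + δ) / 2)) * y α)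
    w hG hG' (by positivity) (by positivity) zero_le_one (by positivity) hH hdH hX hdX
    (sub_le_iff_le_add.2 hmodel)
  clear hG hG' hdH hX hdX hmodel
  -- name the atoms
  obtain ⟨p, hp⟩ : ∃ p : Fin 4 → ℝ, ∀ κ, fderiv ℝ w x (E4.basisVector κ) = p κ := ⟨_, fun _ ↦ rfl⟩
  simp only [hp] at hpert ⊢
  obtain ⟨Kg, hKg⟩ : ∃ Kg : ℝ, multiplierBulk (Kerr.inverseMetric M a)
      (fun y α ↦ if α = 0 then (0 : ℝ) else
        ((E4.spatialNorm y ^ 2) ^ (-(1 / 2 : ℝ)) - (E4.spatialNorm y ^ 2) ^ (-(1 + δ) / 2)) * y α)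
      w x = Kg := ⟨_, rfl⟩
  rw [hKg] at hpert ⊢
  obtain ⟨Qg, hQg⟩ : ∃ Qg : ℝ, ∑ α, ∑ β, Kerr.inverseMetric M a x α β * p α * p β = Qg := ⟨_, rfl⟩
  obtain ⟨S, hS⟩ : ∃ S : ℝ, ∑ μ, p μ ^ 2 = S := ⟨_, rfl⟩
  have hS0 : 0 ≤ S := by rw [← hS]; exact Finset.sum_nonneg fun μ _ ↦ sq_nonneg _
  rw [hS] at hpert
  rw [hQg, hS]
  -- the weight `¼ϖ = c`, `0 ≤ c ≤ 3/(2ρ)`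
  have hw : 4⁻¹ * (4 * ((E4.spatialNorm x ^ 2) ^ (-(1 / 2 : ℝ)) -
      (E4.spatialNorm x ^ 2) ^ (-((1 + δ) / 2)) +
        δ / 2 * (E4.spatialNorm x ^ 2) ^ (-((1 + 2 * δ) / 2))) * Qg) =
      (E4.spatialNorm x ^ (-1 : ℝ) - E4.spatialNorm x ^ (-1 - δ) +
        δ / 2 * E4.spatialNorm x ^ (-1 - 2 * δ)) * Qg := by
    rw [← mul_assoc, largeRWeight_quarter_eq δ hρ]
  rw [hw]
  obtain ⟨hc0, hc⟩ := largeRWeight_quarter_bounds hδ0 hδ1 hρ1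
  obtain ⟨c, hc_eq⟩ : ∃ c : ℝ, E4.spatialNorm x ^ (-1 : ℝ) - E4.spatialNorm x ^ (-1 - δ) +
      δ / 2 * E4.spatialNorm x ^ (-1 - 2 * δ) = c := ⟨_, rfl⟩
  rw [hc_eq] at hc0 hc hpert
  rw [hc_eq]
  -- the quadratic forms `Q_g` versus `Q_η`
  have hQη : ∑ α, ∑ β, Kerr.etaComp α β * p α * p β = -p 0 ^ 2 + (p 1 ^ 2 + p 2 ^ 2 + p 3 ^ 2) :=
    sum_sum_etaComp_mul_mul p
  have hQdiff : |Qg - (-p 0 ^ 2 + (p 1 ^ 2 + p 2 ^ 2 + p 3 ^ 2))| ≤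
      2 * M / Kerr.radius a x * (4 * S) := by
    have h := Kerr.abs_sum_sum_mul_mul_le
      ((Kerr.inverseMetric M a - fun _ : E4 ↦ Kerr.etaComp) x) p p hH
    have hsub : ∑ α, ∑ β, (Kerr.inverseMetric M a - fun _ : E4 ↦ Kerr.etaComp) x α β * p α * p β =
        Qg - ∑ α, ∑ β, Kerr.etaComp α β * p α * p β := by
      rw [← hQg, ← Finset.sum_sub_distrib]
      refine Finset.sum_congr rfl fun α _ ↦ ?_
      rw [← Finset.sum_sub_distrib]
      refine Finset.sum_congr rfl fun β _ ↦ ?_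
      simp only [Pi.sub_apply]
      ring
    rw [hsub, hQη] at h
    refine h.trans ?_
    have hP2 := Kerr.sq_sum_abs_le_four_mul p
    rw [hS] at hP2
    have hMr : 0 ≤ 2 * M / Kerr.radius a x := by positivity
    calc 2 * M / Kerr.radius a x * (∑ μ, |p μ|) * (∑ ν, |p ν|)
        = 2 * M / Kerr.radius a x * (∑ μ, |p μ|) ^ 2 := by ring
      _ ≤ 2 * M / Kerr.radius a x * (4 * S) := mul_le_mul_of_nonneg_left hP2 hMr
  have hQg_lower : c * (-p 0 ^ 2 + (p 1 ^ 2 + p 2 ^ 2 + p 3 ^ 2)) -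
      c * (2 * M / Kerr.radius a x * (4 * S)) ≤ c * Qg := by
    have h := (abs_le.1 hQdiff).1
    have h' : (-p 0 ^ 2 + (p 1 ^ 2 + p 2 ^ 2 + p 3 ^ 2)) - 2 * M / Kerr.radius a x * (4 * S) ≤ Qg := by
      linarith
    have h'' := mul_le_mul_of_nonneg_left h' hc0
    linarith
  -- comparison of the error terms with `1932 M/r²` (`ρ⁻¹ ≤ r⁻¹`)
  have hρK : (E4.spatialNorm x)⁻¹ ≤ (Kerr.radius a x)⁻¹ := inv_anti₀ hr hrρ
  have hMK : 0 ≤ M / Kerr.radius a x := by positivity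
  have t1 : M / Kerr.radius a x * (E4.spatialNorm x)⁻¹ * S ≤ M / Kerr.radius a x ^ 2 * S := by
    calc M / Kerr.radius a x * (E4.spatialNorm x)⁻¹ * S
        ≤ M / Kerr.radius a x * (Kerr.radius a x)⁻¹ * S := by gcongr
      _ = M / Kerr.radius a x ^ 2 * S := by field_simp
  have t2 : c * (M / Kerr.radius a x) * S ≤ 3 / 2 * (M / Kerr.radius a x ^ 2 * S) := by
    have hcK : c ≤ 3 / 2 * (Kerr.radius a x)⁻¹ := hc.trans (by gcongr)
    calc c * (M / Kerr.radius a x) * S ≤ 3 / 2 * (Kerr.radius a x)⁻¹ * (M / Kerr.radius a x) * S := by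
          gcongr
      _ = 3 / 2 * (M / Kerr.radius a x ^ 2 * S) := by field_simp
  have m1 : c * (2 * M / Kerr.radius a x * (4 * S)) = 8 * (c * (M / Kerr.radius a x) * S) := by ring
  have m2 : (24 * (2 * M / Kerr.radius a x) * (4 * (E4.spatialNorm x)⁻¹) +
      8 * 1 * (216 * M / Kerr.radius a x ^ 2)) * S =
      192 * (M / Kerr.radius a x * (E4.spatialNorm x)⁻¹ * S) + 1728 * (M / Kerr.radius a x ^ 2 * S) := by
    ring
  have m3 : (δ / 4 * E4.spatialNorm x ^ (-1 - δ) - 1932 * M / Kerr.radius a x ^ 2) * S =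
      δ / 4 * E4.spatialNorm x ^ (-1 - δ) * S - 1932 * (M / Kerr.radius a x ^ 2 * S) := by ring
  linarith [hpert, hQg_lower, t1, t2, m1, m2, m3]

/-- **The same with the Kerr–Schild radius throughout**: under the hypotheses of
`kerr_largeR_firstOrder_lower_bound` with `r = r(x) ≥ 2^{1/δ}` (so `|y⃗| ≥ r ≥ 2^{1/δ}`) one has
`K^X[g⁻¹] + ¼ϖ ∑ g^{αβ}p_αp_β ≥ ((δ/16) r^{−1−δ} − 1932 M/r²) ∑_μ p_μ²`, because
`|y⃗| ≤ r + |a| ≤ 2r` (`Kerr.norm_le_radius_add_abs`) and `(2r)^{−1−δ} ≥ ¼ r^{−1−δ}`.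
[cite: DafermosRodnianskiShlapentokhrothman2014, §4.6] -/
theorem kerr_largeR_firstOrder_lower_bound_radius {δ M a : ℝ} (hδ0 : 0 < δ) (hδ1 : δ ≤ 1)
    (hM : 0 ≤ M) (w : E4 → ℝ) {x : E4} (hx : (2 : ℝ) ^ (1 / δ) ≤ Kerr.radius a x)
    (hax : |a| ≤ Kerr.radius a x) :
    (δ / 16 * Kerr.radius a x ^ (-1 - δ) - 1932 * M / Kerr.radius a x ^ 2) *
        ∑ μ, fderiv ℝ w x (E4.basisVector μ) ^ 2 ≤
      multiplierBulk (Kerr.inverseMetric M a)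
          (fun y α ↦ if α = 0 then (0 : ℝ) else
            ((E4.spatialNorm y ^ 2) ^ (-(1 / 2 : ℝ)) - (E4.spatialNorm y ^ 2) ^ (-(1 + δ) / 2)) * y α)
          w x +
        4⁻¹ * ((4 * ((E4.spatialNorm x ^ 2) ^ (-(1 / 2 : ℝ)) -
            (E4.spatialNorm x ^ 2) ^ (-((1 + δ) / 2)) +
              δ / 2 * (E4.spatialNorm x ^ 2) ^ (-((1 + 2 * δ) / 2)))) *
          ∑ α, ∑ β, Kerr.inverseMetric M a x α β * fderiv ℝ w x (E4.basisVector α) *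
            fderiv ℝ w x (E4.basisVector β)) := by
  have h2 : 0 < (2 : ℝ) ^ (1 / δ) := Real.rpow_pos_of_pos (by norm_num) _
  have hr : 0 < Kerr.radius a x := h2.trans_le hx
  have hr' : 0 < Kerr.radius a (E4.ofTimeSpace 0 (E4.spatial x)) := by
    rwa [Kerr.radius_ofTimeSpace_spatial]
  have hrρ : Kerr.radius a x ≤ E4.spatialNorm x := by
    have h := Kerr.radius_le_norm hr'
    rwa [Kerr.radius_ofTimeSpace_spatial] at h
  have hρr : E4.spatialNorm x ≤ 2 * Kerr.radius a x := by
    have h := Kerr.norm_le_radius_add_abs hr'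
    rw [Kerr.radius_ofTimeSpace_spatial] at h
    change E4.spatialNorm x ≤ _ at h
    linarith
  have hmain := kerr_largeR_firstOrder_lower_bound hδ0 hδ1 hM w (hx.trans hrρ) hr hax
  refine le_trans ?_ hmain
  have hS0 : 0 ≤ ∑ μ, fderiv ℝ w x (E4.basisVector μ) ^ 2 := Finset.sum_nonneg fun μ _ ↦ sq_nonneg _
  refine mul_le_mul_of_nonneg_right ?_ hS0
  -- `(δ/16) r^{-1-δ} ≤ (δ/4) ρ^{-1-δ}`
  have hpow : E4.spatialNorm x ^ (-1 - δ) ≥ (2 * Kerr.radius a x) ^ (-1 - δ) :=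
    Real.rpow_le_rpow_of_nonpos (hr.trans_le hrρ) hρr (by linarith)
  have hsplit : (2 * Kerr.radius a x) ^ (-1 - δ) = (2 : ℝ) ^ (-1 - δ) * Kerr.radius a x ^ (-1 - δ) :=
    Real.mul_rpow zero_le_two hr.le
  have h2pow : (1 / 4 : ℝ) ≤ (2 : ℝ) ^ (-1 - δ) := by
    calc (1 / 4 : ℝ) = (2 : ℝ) ^ (-2 : ℝ) := by
          rw [Real.rpow_neg zero_le_two, Real.rpow_two]; norm_num
      _ ≤ (2 : ℝ) ^ (-1 - δ) := Real.rpow_le_rpow_of_exponent_le one_le_two (by linarith)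
  have hK0 : 0 ≤ Kerr.radius a x ^ (-1 - δ) := Real.rpow_nonneg hr.le _
  have h3 : 1 / 4 * Kerr.radius a x ^ (-1 - δ) ≤ E4.spatialNorm x ^ (-1 - δ) :=
    calc 1 / 4 * Kerr.radius a x ^ (-1 - δ) ≤ (2 : ℝ) ^ (-1 - δ) * Kerr.radius a x ^ (-1 - δ) :=
          mul_le_mul_of_nonneg_right h2pow hK0
      _ = (2 * Kerr.radius a x) ^ (-1 - δ) := hsplit.symm
      _ ≤ E4.spatialNorm x ^ (-1 - δ) := hpow
  have h4 := mul_le_mul_of_nonneg_left h3 (by positivity : (0 : ℝ) ≤ δ / 4)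
  linarith

/-- **Coercivity of the first-order bulk for large `r`**: under the hypotheses of
`kerr_largeR_firstOrder_lower_bound_radius`, if moreover `δ r^{1−δ} ≥ 61824 M` (i.e.
`1932 M/r² ≤ (δ/32) r^{−1−δ}`; for `δ < 1` a largeness condition `r ≥ R(δ, M)`), then
`K^X[g⁻¹_{M,a}](x) + ¼ϖ(x) ∑_{αβ} g^{αβ}p_αp_β ≥ (δ/32) r^{−1−δ} ∑_μ (∂_μw)²(x)` — the Kerr form
of Dafermos–Rodnianski's `K^{X,w} ≥ b(δ) r^{−1−δ}|∂ψ|²` for `r ≥ R` (arXiv:1010.5132, §6;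
DRSR arXiv:1402.7034, §4.6, Prop. 4.6.1). [cite: DafermosRodnianskiShlapentokhrothman2014, §4.6] -/
theorem kerr_largeR_firstOrder_coercive {δ M a : ℝ} (hδ0 : 0 < δ) (hδ1 : δ ≤ 1) (hM : 0 ≤ M)
    (w : E4 → ℝ) {x : E4} (hx : (2 : ℝ) ^ (1 / δ) ≤ Kerr.radius a x)
    (hax : |a| ≤ Kerr.radius a x) (hlarge : 61824 * M ≤ δ * Kerr.radius a x ^ (1 - δ)) :
    δ / 32 * Kerr.radius a x ^ (-1 - δ) * ∑ μ, fderiv ℝ w x (E4.basisVector μ) ^ 2 ≤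
      multiplierBulk (Kerr.inverseMetric M a)
          (fun y α ↦ if α = 0 then (0 : ℝ) else
            ((E4.spatialNorm y ^ 2) ^ (-(1 / 2 : ℝ)) - (E4.spatialNorm y ^ 2) ^ (-(1 + δ) / 2)) * y α)
          w x +
        4⁻¹ * ((4 * ((E4.spatialNorm x ^ 2) ^ (-(1 / 2 : ℝ)) -
            (E4.spatialNorm x ^ 2) ^ (-((1 + δ) / 2)) +
              δ / 2 * (E4.spatialNorm x ^ 2) ^ (-((1 + 2 * δ) / 2)))) *
          ∑ α, ∑ β, Kerr.inverseMetric M a x α β * fderiv ℝ w x (E4.basisVector α) *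
            fderiv ℝ w x (E4.basisVector β)) := by
  have h2 : 0 < (2 : ℝ) ^ (1 / δ) := Real.rpow_pos_of_pos (by norm_num) _
  have hr : 0 < Kerr.radius a x := h2.trans_le hx
  refine le_trans ?_ (kerr_largeR_firstOrder_lower_bound_radius hδ0 hδ1 hM w hx hax)
  have hS0 : 0 ≤ ∑ μ, fderiv ℝ w x (E4.basisVector μ) ^ 2 := Finset.sum_nonneg fun μ _ ↦ sq_nonneg _
  refine mul_le_mul_of_nonneg_right ?_ hS0
  set r := Kerr.radius a x with hr_def
  -- `1932 M / r² ≤ (δ/32) r^{-1-δ}` from `61824 M ≤ δ r^{1-δ} = δ r^{-1-δ} r²`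
  have hpow : r ^ (1 - δ) = r ^ (-1 - δ) * r ^ 2 := by
    rw [← Real.rpow_two, ← Real.rpow_add hr]; ring_nf
  have hr2 : 0 < r ^ 2 := by positivity
  have hkey : 1932 * M / r ^ 2 ≤ δ / 32 * r ^ (-1 - δ) := by
    rw [div_le_iff₀ hr2]
    rw [hpow] at hlarge
    linarith
  linarith

end KerrSchild

end Literature.Geometry.Lorentzian

end
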